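import Summits.BirchSwinnertonDyer.BirchSwinnertonDyer.Theorems.ManinLocalTwoThreeAdditiveDyadicTransport
import Summits.BirchSwinnertonDyer.BirchSwinnertonDyer.Theorems.ManinLocalTwoThreeOddUntwistReductions
import HarnessLib

/-!
# Route `ManinLocalTwoThree` (cell `bsd-f2-manin`): crux C2 `ManinOddAtFour` (stmt-BirchSwinnertonDyer-22967)
# REDUCED to Manin's conjecture at `2` on the DYADIC-LEVEL-MINIMAL globally-twist-minimal classes

Sequel of `ManinLocalTwoThreeAdditiveDyadicTransport.lean` (additive → additive dyadic transport: `χ₋₄` exact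
by Connell–Pal, `χ±8` exact when the minimal discriminants are aligned) and of
`ManinLocalTwoThreeOddUntwistReductions.lean` (seat p2 gen 0: C2 ⟸ the globally-twist-minimal core `H₂` =
no semistable untwist, dyadic or odd). Main theorem `maninLocalTwoThree_maninOddAtFour_of_dyadicLevelMinimal`:
the route decl `ManinOddAtFour` BY NAME follows from ONE hypothesis — `2 ∤ c` for the lattice-optimal data
with `4 ∣ N` whose class has (i) no dyadic untwist to a `2`-semistable class, (ii) no odd semistable untwist,
(iii) no `χ₋₄`-untwist to an ADDITIVE class of lower conductor dividing `N` (`2⁴ ∣ N`), (iv) no aligned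
`χ±8`-untwist to a lattice-optimal ADDITIVE curve of conductor dividing `N` (`2⁶ ∣ N`) that is of lower
conductor or commuting (`C = W`). Lexicographic induction on (level, `|Δ_min|`); every untwist either is
closed by print (i) or moves `2 ∤ c` up from a lower level / from the partner with smaller `|Δ_min|`.

CENSUS of the residue (this seat's join of the cell table TWISTCENSUS2 — data seat, PARI engine 2 — over the
897 670 optimal classes with `4 ∣ N ≤ 5·10⁵`; local awk, 21 s): dyadically twist-minimal core 700 867
(seat p1: 700 867) → globally twist-minimal `H₂` 487 948 (p1: 487 948) → DYADIC-LEVEL-MINIMAL residue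
**320 383**, by `v₂(N)`: `2`: 114 549 · `3`: 114 762 · `4`: **0** (all 129 623 core classes at `v₂ = 4` are
`χ₋₄`-lifts of additive classes at `v₂ ∈ {2,3}`) · `5`: 55 597 · `6`: 10 375 (the misaligned `χ±8`-lifts of
`v₂ = 5` classes; 90 667 aligned lifts removed) · `7`: 17 256 · `8`: 7 844 (same-level commuting aligned
`χ±8`-partners removed at `v₂ ∈ {7, 8}`: 11 164). So the open content of C2 is Manin's conjecture at `2` for
the optimal curves that are CONDUCTOR- and `|Δ|`-MINIMAL in their quadratic-twist class: `v₂(N) ∈ {2, 3}`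
(tame and `Q₈/SL₂(𝔽₃)` types), `v₂(N) ∈ {5, 7, 8}`, and the misaligned `v₂(N) = 6` lifts. OPEN; nothing here
proves BSD or Manin's conjecture. Seat bsd-line-manin23-p2 (gen 2).

References: [Stevens1989] Lemmas (5.2), (5.4); [Cesnavicius2018] Thm. 1.2; [Pal2012] Prop. 2.4, Lemma 3.1;
[SilvermanATAEC1994] IV.9.4.
-/

set_option autoImplicit false
set_option linter.dupNamespace false

noncomputable section

open scoped MatrixGroups ModularForm Classical NumberField

namespace Summit.BirchSwinnertonDyer.BirchSwinnertonDyer.Theorems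

open CongruenceSubgroup WeierstrassCurve IsDedekindDomain IsDedekindDomain.HeightOneSpectrum
  Rat.HeightOneSpectrum Literature.NumberTheory.Automorphic
  Literature.NumberTheory.EllipticCurves Literature.NumberTheory.EllipticCurves.ModularForms
  Summit.BirchSwinnertonDyer.Rank1Residual.ManinAdditive

/-! ## §5 C2 `ManinOddAtFour` ⟸ Manin at `2` on the DYADIC-LEVEL-MINIMAL globally-twist-minimal core -/

/-- `2² ∣ N(W')` is inherited along an odd twist `W ∼ W' ⊗ ℚ(√q*)` (`q ≠ 2`; conductor exponents agree
off `q`, granted modularity). [cite: SilvermanATAEC1994, IV.9.4 and Exercise 4.40] -/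
theorem maninLocalTwoThree_four_dvd_conductorNorm_of_isIsogenous_twist_pStar
    (hnf : exists_isNewformOf) {q : ℕ} [Fact q.Prime] (hq2 : q ≠ 2)
    {W : WeierstrassCurve ℚ} [W.IsElliptic] {W' : WeierstrassCurve ℚ} [W'.IsElliptic]
    (htw : IsIsogenous W (W'.quadraticTwist (((-1 : ℤ) ^ (q / 2) * q : ℤ) : ℚ)))
    (h4 : 2 ^ 2 ∣ W.conductorNorm ℤ) : 2 ^ 2 ∣ W'.conductorNorm ℤ := by
  have hv2 : natGenerator ((primesEquiv (R := ℤ)).symm ⟨2, Nat.prime_two⟩) ≠ q := by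
    rw [natGenerator_primesEquiv_symm Nat.prime_two]; exact fun h ↦ hq2 h.symm
  have h2W : 2 ≤ (W.conductorNorm ℤ).factorization 2 :=
    (Nat.prime_two.pow_dvd_iff_le_factorization (conductorNorm_pos_holds W).ne').mp h4
  refine (Nat.prime_two.pow_dvd_iff_le_factorization (conductorNorm_pos_holds W').ne').mpr ?_
  have hf2 := maninLocalTwoThree_conductorExponent_eq_of_isIsogenous_twist_pStar hnf hq2 htw
    ((primesEquiv (R := ℤ)).symm ⟨2, Nat.prime_two⟩) hv2
  have e1 := factorization_conductorNorm_primesEquiv_symm W ⟨2, Nat.prime_two⟩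
  have e2 := factorization_conductorNorm_primesEquiv_symm W' ⟨2, Nat.prime_two⟩
  simp only at e1 e2
  rw [e2, ← hf2, ← e1]
  exact h2W

/-- `Δ(W) = d⁶ Δ(A)` with `d = ±2` between globally minimal curves forces `|Δ_min(A)| < |Δ_min(W)|` (as
integers: `Δ_min(W) = 64 Δ_min(A) ≠ 0`). [elementary] -/
theorem maninLocalTwoThree_natAbs_minimalDiscriminantInt_lt_of_Δ_eq {d : ℤ} (hd : d = 2 ∨ d = -2)
    {A W : WeierstrassCurve ℚ} [A.IsElliptic] [A.IsGloballyMinimal] [W.IsElliptic] [W.IsGloballyMinimal]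
    (hΔ : W.Δ = (d : ℚ) ^ 6 * A.Δ) :
    A.minimalDiscriminantInt.natAbs < W.minimalDiscriminantInt.natAbs := by
  have hd6 : (d : ℚ) ^ 6 = 64 := by rcases hd with rfl | rfl <;> norm_num
  rw [hd6, ← cast_minimalDiscriminantInt W, ← cast_minimalDiscriminantInt A] at hΔ
  have hZ : W.minimalDiscriminantInt = 64 * A.minimalDiscriminantInt := by exact_mod_cast hΔ
  have hA0 : A.minimalDiscriminantInt ≠ 0 := A.minimalDiscriminantInt_ne_zero
  rw [hZ, Int.natAbs_mul]
  have hpos : 0 < A.minimalDiscriminantInt.natAbs := Int.natAbs_pos.mpr hA0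
  have h64 : (64 : ℤ).natAbs = 64 := rfl
  rw [h64]
  omega

/-- **Crux C2 `ManinOddAtFour` ⟸ Manin's conjecture at `2` on the DYADIC-LEVEL-MINIMAL globally
twist-minimal optimal classes** (one hypothesis, kernel-checked composition). Modulo the four printed
facts, it suffices to prove `2 ∤ c` for the lattice-optimal data `D` with `4 ∣ N` whose class admits
(i) no dyadic untwist to a class semistable at `2`, (ii) no odd semistable untwist `χ_{q*}` (`q ≠ 2`,
`q² ∣ N`), (iii) no `χ₋₄`-untwist to an ADDITIVE class of LOWER conductor `N' ∣ N` (with `2⁴ ∣ N`), and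
(iv) no ALIGNED `χ±8`-untwist to a lattice-optimal additive curve `A` of conductor `N' ∣ N` (with `2⁶ ∣ N`;
aligned = the minimal model `C` of `A ⊗ ℚ(√±2)` has `Δ(C) = d⁶Δ(A)`) which is EITHER of lower conductor OR
commuting at the same level (`C = W`). Lexicographic induction on (level, `|Δ_min|`): an untwist of type
(i) is closed by the landed `maninLocalTwoThree_maninOddAtFour_twistCovered` (Stevens `η = 1` + E-an-1
`η = 2` + Česnavičius), one of type (ii)/(iii)/(iv, lower) transports `2 ∤ c` up from the lower level
(`…_of_oddUntwist`, `…_of_additiveUntwist_negOne`, `…_of_additiveUntwist_two_aligned`), one of type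
(iv, same level) from the partner with `|Δ_min|` smaller by `2⁶`. Census of the residue (cell table
TWISTCENSUS2, this seat's join; optimal classes with `4 ∣ N ≤ 5·10⁵`): 320 383 of 897 670 (core 700 867,
globally twist-minimal 487 948), by `v₂(N)`: `2`: 114 549 · `3`: 114 762 · `4`: 0 · `5`: 55 597 ·
`6`: 10 375 · `7`: 17 256 · `8`: 7 844. OPEN on that residue (no printed theorem); nothing here proves BSD or
Manin's conjecture. [cite: Stevens1989, Lemmas (5.2), (5.4)] [cite: Cesnavicius2018, Thm. 1.2]
[cite: Pal2012, Prop. 2.4, Lemma 3.1] -/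
theorem maninLocalTwoThree_maninOddAtFour_of_dyadicLevelMinimal
    (H : Literature.NumberTheory.EllipticCurves.ModularForms.mazur_not_dvd_maninConstant_of_odd →
      Literature.NumberTheory.EllipticCurves.ModularForms.abbesUllmo_not_dvd_maninConstant_of_not_dvd_level →
      Literature.NumberTheory.EllipticCurves.ModularForms.cesnavicius_not_two_dvd_maninConstant_of_two_dvd_level →
      Literature.NumberTheory.EllipticCurves.ModularForms.exists_isNewformOf →
      ∀ (W : WeierstrassCurve ℚ) [W.IsElliptic] [W.IsGloballyMinimal] {N : ℕ} [NeZero N]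
        (D : ModularParametrizationData W N),
        (∀ z ∈ D.L.lattice, ∃ w ∈ periodLattice D.f, z = D.c * w) → 2 ^ 2 ∣ N →
        ¬ (∃ (W' : WeierstrassCurve ℚ) (d : ℤ), W'.IsElliptic ∧ W'.IsGloballyMinimal ∧
          (d = -1 ∨ d = 2 ∨ d = -2) ∧ IsIsogenous W (W'.quadraticTwist (d : ℚ)) ∧
          ¬ 2 ^ 2 ∣ W'.conductorNorm ℤ) →
        ¬ (∃ (W' : WeierstrassCurve ℚ) (q : ℕ), W'.IsElliptic ∧ W'.IsGloballyMinimal ∧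
          q.Prime ∧ q ≠ 2 ∧ q ^ 2 ∣ N ∧
          IsIsogenous W (W'.quadraticTwist (((-1 : ℤ) ^ (q / 2) * q : ℤ) : ℚ)) ∧
          ¬ q ^ 2 ∣ W'.conductorNorm ℤ) →
        ¬ (∃ (A : WeierstrassCurve ℚ), A.IsElliptic ∧ A.IsGloballyMinimal ∧ 2 ^ 4 ∣ N ∧
          2 ^ 2 ∣ A.conductorNorm ℤ ∧ A.conductorNorm ℤ ∣ N ∧ A.conductorNorm ℤ < N ∧
          IsIsogenous W (A.quadraticTwist ((-1 : ℤ) : ℚ))) →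
        ¬ (∃ (A : WeierstrassCurve ℚ) (_ : A.IsElliptic) (_ : A.IsGloballyMinimal) (N' : ℕ) (_ : NeZero N')
          (D' : ModularParametrizationData A N') (d : ℤ) (C : WeierstrassCurve ℚ) (u : VariableChange ℚ),
          C.IsElliptic ∧ C.IsGloballyMinimal ∧
          (∀ z ∈ D'.L.lattice, ∃ w ∈ periodLattice D'.f, z = D'.c * w) ∧ (d = 2 ∨ d = -2) ∧ 2 ^ 6 ∣ N ∧
          2 ^ 2 ∣ A.conductorNorm ℤ ∧ A.conductorNorm ℤ ∣ N ∧
          IsIsogenous W (A.quadraticTwist (d : ℚ)) ∧ u • A.quadraticTwist (d : ℚ) = C ∧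
          C.Δ = (d : ℚ) ^ 6 * A.Δ ∧ (A.conductorNorm ℤ < N ∨ C = W)) →
        ¬ (2 : ℤ) ∣ D.maninConstant) :
    Summit.BirchSwinnertonDyer.BirchSwinnertonDyer.Theses.ManinLocalTwoThree.ManinOddAtFour := by
  intro hM hAU hC2 hnf
  suffices key : ∀ (n m : ℕ) (W : WeierstrassCurve ℚ) [W.IsElliptic] [W.IsGloballyMinimal] (N : ℕ)
      [NeZero N] (D : ModularParametrizationData W N), N < n → W.minimalDiscriminantInt.natAbs < m →
      (∀ z ∈ D.L.lattice, ∃ w ∈ periodLattice D.f, z = D.c * w) → 2 ^ 2 ∣ N →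
      ¬ (2 : ℤ) ∣ D.maninConstant by
    intro W _ _ N _ D hopt h4
    exact key (N + 1) (W.minimalDiscriminantInt.natAbs + 1) W N D (Nat.lt_succ_self N)
      (Nat.lt_succ_self _) hopt h4
  intro n
  induction n with
  | zero => intro m W _ _ N _ D hN; exact absurd hN (Nat.not_lt_zero N)
  | succ n ihN =>
    intro m
    induction m with
    | zero => intro W _ _ N _ D _ hm; exact absurd hm (Nat.not_lt_zero _)
    | succ m ihm =>
    intro W _ _ N _ D hNn hmm hopt h4
    have hN : N = W.conductorNorm ℤ :=
      IsNewformOf.level_eq_conductorNorm_of_exists_isNewformOf hnf D.isNewformOf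
    -- (i) a dyadic untwist to a class semistable at `2`: closed (twist-covered half)
    by_cases h1 : ∃ (W' : WeierstrassCurve ℚ) (d : ℤ), W'.IsElliptic ∧ W'.IsGloballyMinimal ∧
        (d = -1 ∨ d = 2 ∨ d = -2) ∧ IsIsogenous W (W'.quadraticTwist (d : ℚ)) ∧
        ¬ 2 ^ 2 ∣ W'.conductorNorm ℤ
    · exact maninLocalTwoThree_maninOddAtFour_twistCovered hM hAU hC2 hnf W D hopt h4 h1
    -- (ii) an odd semistable untwist: transport + induction on the level
    by_cases h2 : ∃ (W' : WeierstrassCurve ℚ) (q : ℕ), W'.IsElliptic ∧ W'.IsGloballyMinimal ∧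
        q.Prime ∧ q ≠ 2 ∧ q ^ 2 ∣ N ∧
        IsIsogenous W (W'.quadraticTwist (((-1 : ℤ) ^ (q / 2) * q : ℤ) : ℚ)) ∧
        ¬ q ^ 2 ∣ W'.conductorNorm ℤ
    · obtain ⟨W', q, hE', hM', hqp, hq2, hqN, htw, hqN'⟩ := h2
      haveI := hE'
      haveI := hM'
      haveI : Fact q.Prime := ⟨hqp⟩
      refine maninLocalTwoThree_not_dvd_maninConstant_of_oddUntwist hnf hq2 D hopt hqN htw hqN' ?_
      intro W₁ _ _ N₁ _ D₁ hiso₁ hopt₁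
      have hN₁ : N₁ = W'.conductorNorm ℤ := level_eq_conductorNorm_of_isIsogenous hnf D₁ hiso₁
      have hqNW : q ^ 2 ∣ W.conductorNorm ℤ := hN ▸ hqN
      have hadd : ¬ W.HasGoodReductionAtPrime q ∧ ¬ W.HasMultiplicativeReductionAtPrime q :=
        not_good_and_not_mult_of_sq_dvd_conductorNorm W hqNW
      have hN'N : W'.conductorNorm ℤ ∣ W.conductorNorm ℤ :=
        maninLocalTwoThree_conductorNorm_dvd_of_isIsogenous_twist_pStar hnf hq2 htw hqN' hadd
      have hlt : N₁ < N := by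
        rw [hN₁, hN]
        refine lt_of_le_of_ne (Nat.le_of_dvd (conductorNorm_pos_holds W) hN'N) fun h ↦ hqN' ?_
        rw [h]; exact hqNW
      have h4₁ : 2 ^ 2 ∣ N₁ := by
        rw [hN₁]
        exact maninLocalTwoThree_four_dvd_conductorNorm_of_isIsogenous_twist_pStar hnf hq2 htw (hN ▸ h4)
      exact ihN _ W₁ N₁ D₁ (by omega) (Nat.lt_succ_self _) hopt₁ h4₁
    -- (iii) a `χ₋₄`-untwist to an additive class of lower conductor: transport + induction on the level
    by_cases h3 : ∃ (A : WeierstrassCurve ℚ), A.IsElliptic ∧ A.IsGloballyMinimal ∧ 2 ^ 4 ∣ N ∧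
        2 ^ 2 ∣ A.conductorNorm ℤ ∧ A.conductorNorm ℤ ∣ N ∧ A.conductorNorm ℤ < N ∧
        IsIsogenous W (A.quadraticTwist ((-1 : ℤ) : ℚ))
    · obtain ⟨A, hAe, hAm, h16, h4A, hAN, hlt, htw⟩ := h3
      haveI := hAe
      haveI := hAm
      refine maninLocalTwoThree_not_dvd_maninConstant_of_additiveUntwist_negOne hnf D hopt h16 htw h4A
        hAN ?_
      intro W₁ _ _ N₁ _ D₁ hiso₁ hopt₁
      have hN₁ : N₁ = A.conductorNorm ℤ := level_eq_conductorNorm_of_isIsogenous hnf D₁ hiso₁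
      exact ihN _ W₁ N₁ D₁ (by omega) (Nat.lt_succ_self _) hopt₁ (hN₁ ▸ h4A)
    -- (iv) an aligned `χ±8`-untwist to a lattice-optimal additive curve, of lower conductor or commuting
    by_cases h5 : ∃ (A : WeierstrassCurve ℚ) (_ : A.IsElliptic) (_ : A.IsGloballyMinimal) (N' : ℕ)
        (_ : NeZero N') (D' : ModularParametrizationData A N') (d : ℤ) (C : WeierstrassCurve ℚ)
        (u : VariableChange ℚ),
        C.IsElliptic ∧ C.IsGloballyMinimal ∧
        (∀ z ∈ D'.L.lattice, ∃ w ∈ periodLattice D'.f, z = D'.c * w) ∧ (d = 2 ∨ d = -2) ∧ 2 ^ 6 ∣ N ∧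
        2 ^ 2 ∣ A.conductorNorm ℤ ∧ A.conductorNorm ℤ ∣ N ∧
        IsIsogenous W (A.quadraticTwist (d : ℚ)) ∧ u • A.quadraticTwist (d : ℚ) = C ∧
        C.Δ = (d : ℚ) ^ 6 * A.Δ ∧ (A.conductorNorm ℤ < N ∨ C = W)
    · obtain ⟨A, hAe, hAm, N', hN'0, D', d, C, u, hCe, hCm, hopt', hd, h64, h4A, hAN, htw, hu, hΔ, hlow⟩ :=
        h5
      haveI := hCe
      haveI := hCm
      have hN' : N' = A.conductorNorm ℤ :=
        IsNewformOf.level_eq_conductorNorm_of_exists_isNewformOf hnf D'.isNewformOf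
      refine maninLocalTwoThree_not_dvd_maninConstant_of_additiveUntwist_two_aligned hnf D hopt h64 hd
        D' htw h4A hAN u hu hΔ ?_
      have h4N' : 2 ^ 2 ∣ N' := hN' ▸ h4A
      rcases hlow with hlt | hCW
      · exact ihN _ A N' D' (by omega) (Nat.lt_succ_self _) hopt' h4N'
      · subst hCW
        have hle : N' ≤ N := hN' ▸ Nat.le_of_dvd (Nat.pos_of_ne_zero (NeZero.ne N)) hAN
        have hmA : A.minimalDiscriminantInt.natAbs < m :=
          lt_of_lt_of_le (maninLocalTwoThree_natAbs_minimalDiscriminantInt_lt_of_Δ_eq hd hΔ) (by omega)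
        exact ihm A N' D' (by omega) hmA hopt' h4N'
    · exact H hM hAU hC2 hnf W D hopt h4 h1 h2 h3 h5

end Summit.BirchSwinnertonDyer.BirchSwinnertonDyer.Theorems

end
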